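import Mathlib.Analysis.SpecialFunctions.Log.Base
import Mathlib.Analysis.SpecialFunctions.Pow.Real
import Mathlib.Combinatorics.SimpleGraph.Coloring.Vertex
import Literature.ModelTheory.FiniteModelTheory.CohomologicalConsistency
import HarnessLib

/-!
# Random regular graphs fool cohomological `k`-consistency for 3-colourability at linear level
# (Conneryd–Ghannane–Pang 2025, Theorem 6.1)

Topic `Literature/ModelTheory/FiniteModelTheory`; ONE named fact (`def … : Prop`, statement only,
D-0014) and two proved corollaries.  Grounds route `PneNP/DescentTower`, item
`Summit.PneNP.PneNP.Theses.DescentTower.CohConsistencyFooledByThreeCol` (stmt-PneNP-2537: "for every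
`k` some non-3-colourable graph passes Ó Conghaile's cohomological `k`-consistency w.r.t. `K₃`"):
the `K₃` case is in print DIRECTLY, so no transfer from another template (the informal support
`TransferUnderGadgets`) is needed for that item — only the bridge between the tree's notion
`GraphCohomologicallyKConsistent k G ⊤` (file `CohomologicalConsistency.lean`, Ó Conghaile's
Definition 5 for the presheaf of partial graph homomorphisms) and the item's inline rendering.
The companion fact `LichterPago2025_cohomologyFooled` (`CohomologicalConsistencyLimits.lean`) is the
template-anonymous `∃ T` form and cites the same source; this file records the quantitative `K₃`
statement itself.

## Source, as printed

J. Conneryd, Y. Ghannane, S. Pang, *Lower Bounds for CSP Hierarchies Through Ideal Reduction*,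
SODA 2026 = arXiv:2511.17272 [ConnerydGhannanePang2025], §6 (read: `lit read arxiv:2511.17272`,
chunk 21 of the held text):

> **Theorem 6.1.** There is an absolute constant `C` such that the following holds for natural
> numbers `n` and `d` such that `d ≥ 10` and `6d³ ≤ log n`. With high probability as `n → ∞`, a
> graph `G ∼ 𝒢_{n,d}` has chromatic number strictly larger than `d/4 log d`, but the cohomological
> `k`-consistency algorithm for `3`-colorability accepts `G` for all `k ≤ n·d^{-Cd}`.
> Consequently, the cohomological `k`-consistency algorithm does not solve `3` vs.
> `d/4 log d`-coloring on `n`-vertex graphs, for any `k ≤ n·d^{-Cd}`.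

(`𝒢_{n,d}` = the uniform distribution on `d`-regular graphs on `n` vertices; footnote: "a
`d`-regular graph on `n` vertices can only exist if `dn` is even. We ignore this technical issue";
the algorithm is the box of §2.6 = Ó Conghaile 2022 = Lichter–Pago §5.4, i.e. Definition 5;
proof via the polynomial-calculus degree lower bound of [CdRNPR25] and Lemma 5.x, with Lemma 6.2
`χ(G) > d/(4 log d)` whp for `d ≤ n^{0.1}` [KPGW10, CFRR02].)

## Rendering

* "With high probability as `n → ∞` a sample of `𝒢_{n,d}` has property `P`" implies, for every
  fixed `d`, that for all large `n` with `dn` even SOME `d`-regular graph on `n` vertices has `P`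
  (the model is non-empty exactly when `dn` is even and `n ≥ d + 1`); we vendor this deterministic
  consequence, `∀ᶠ n in atTop, Even (d * n) → ∃ G, …`, which also absorbs the hypothesis
  `6d³ ≤ log n` (eventually true for fixed `d`).  No probability space over graphs is needed.
* "chromatic number strictly larger than `d/4 log d`" ↦ `¬ G.Colorable m` for every `m` with
  `m ≤ d/(4 log₂ d)`.  The base of `log` is not fixed in the source; the binary logarithm gives
  the SMALLER threshold, so this rendering is implied by either reading (never stronger than print).
* "accepted by the cohomological `k`-consistency algorithm for `3`-colorability" ↦
  `GraphCohomologicallyKConsistent k G (⊤ : SimpleGraph (Fin 3))` (`K₃` = the complete graph on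
  `Fin 3`; `graphCohomologicallyKConsistent_iff` identifies it with the model-theoretic
  `CohomologicallyKConsistent` in the language of graphs).
* `d`-regular ↦ `Nat.card (G.neighborSet v) = d` for every vertex `v` (instance-free form of
  Mathlib's `SimpleGraph.IsRegularOfDegree`); `k ≤ n·d^{-Cd}` verbatim over `ℝ`
  (`Real.rpow`).

Proved below from the fact: `connerydGhannanePang2025_thm_6_1.linear` (a constant `c > 0` with
non-3-colourable `n`-vertex graphs accepted at level `⌊c n⌋₊` for all large `n` — the `d = 128`
instance) and `.const` (for every level `k` a non-3-colourable graph accepted at level `k` — the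
shape of crux `CohConsistencyFooledByThreeCol` over the tree notion).

NOT here: the Erdős–Rényi variant (stated without proof in the source), Theorem 7.4 (= Chan–Ng
2025 Thm 1.3, lax null-constraining uniform hypergraph templates), the SDA / C(BLP+AIP) results,
and any formalisation of the proof (closure/ideal-reduction operators).

## References

* [ConnerydGhannanePang2025] J. Conneryd, Y. Ghannane, S. Pang, Lower Bounds for CSP Hierarchies
  Through Ideal Reduction, arXiv:2511.17272 (SODA 2026), Thm. 6.1, Lemma 6.2, §2.6. READ.
* [OConghaile2022] A. Ó Conghaile, Cohomology in Constraint Satisfaction and Structure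
  Isomorphism, MFCS 2022, Def. 5.
* [ChanNg2025] S. O. Chan, H. T. Ng, How random CSPs fool hierarchies II, STOC 2025, Thm. 1.3.
-/

noncomputable section

namespace Literature.ModelTheory.FiniteModelTheory

open _root_.Filter
open scoped _root_.Topology

/-- **Conneryd–Ghannane–Pang 2025, Theorem 6.1 (random regular graphs fool cohomological
`k`-consistency for 3-colourability up to a linear level)** — NAMED FACT, statement only, in the
deterministic-consequence form explained in the module docstring.  Printed (arXiv:2511.17272
§6): *"There is an absolute constant `C` such that the following holds for natural numbers `n`
and `d` such that `d ≥ 10` and `6d³ ≤ log n`. With high probability as `n → ∞`, a graph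
`G ∼ 𝒢_{n,d}` has chromatic number strictly larger than `d/4 log d`, but the cohomological
`k`-consistency algorithm for `3`-colorability accepts `G` for all `k ≤ n · d^{-Cd}`."*
Rendered: there is `C > 0` such that for every `d ≥ 10`, for all large `n` with `dn` even, some
`d`-regular simple graph `G` on `Fin n` is not `m`-colourable for any `m ≤ d/(4 log₂ d)` and is
cohomologically `k`-consistent w.r.t. `K₃ = ⊤ : SimpleGraph (Fin 3)` (tree notion
`GraphCohomologicallyKConsistent`, Ó Conghaile's Def. 5) for every `k ≤ n · d^{-Cd}`.
Grounds `Summit.PneNP.PneNP.Theses.DescentTower.CohConsistencyFooledByThreeCol`.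
[cite: ConnerydGhannanePang2025, Thm. 6.1 (with Lemma 6.2 and §2.6)] [cite: OConghaile2022, Def. 5] -/
def connerydGhannanePang2025_thm_6_1 : Prop :=
  ∃ C : ℝ, 0 < C ∧ ∀ d : ℕ, 10 ≤ d →
    ∀ᶠ n : ℕ in atTop, Even (d * n) →
      ∃ G : SimpleGraph (Fin n), (∀ v : Fin n, Nat.card (G.neighborSet v) = d) ∧
        (∀ m : ℕ, (m : ℝ) ≤ (d : ℝ) / (4 * Real.logb 2 d) → ¬ G.Colorable m) ∧
        ∀ k : ℕ, (k : ℝ) ≤ (n : ℝ) * (d : ℝ) ^ (-(C * d)) →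
          GraphCohomologicallyKConsistent k G (⊤ : SimpleGraph (Fin 3))

namespace connerydGhannanePang2025_thm_6_1

/-- **Corollary (`d = 128`): non-3-colourable graphs accepted at a LINEAR level.**  There is
`c > 0` such that for all large `n` some graph on `Fin n` is not 3-colourable but cohomologically
`k`-consistent w.r.t. `K₃` for every `k ≤ c·n` (`128/(4 log₂ 128) = 128/28 > 3`; `128·n` is
always even).  PROVED from the named fact. [cite: ConnerydGhannanePang2025, Thm. 6.1] -/
theorem linear (h : connerydGhannanePang2025_thm_6_1) :
    ∃ c : ℝ, 0 < c ∧ ∀ᶠ n : ℕ in atTop, ∃ G : SimpleGraph (Fin n), ¬ G.Colorable 3 ∧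
      ∀ k : ℕ, (k : ℝ) ≤ c * n → GraphCohomologicallyKConsistent k G (⊤ : SimpleGraph (Fin 3)) := by
  obtain ⟨C, hC, hd⟩ := h
  refine ⟨(128 : ℝ) ^ (-(C * 128)), Real.rpow_pos_of_pos (by norm_num) _, ?_⟩
  filter_upwards [hd 128 (by norm_num)] with n hn
  obtain ⟨G, -, hcol, hk⟩ := hn ⟨64 * n, by ring⟩
  refine ⟨G, hcol 3 ?_, fun k hkn => hk k (by simpa [mul_comm] using hkn)⟩
  -- `3 ≤ 128 / (4 * log₂ 128)`, since `log₂ 128 = 7`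
  have h7 : Real.logb 2 (128 : ℕ) = 7 := by
    rw [show ((128 : ℕ) : ℝ) = (2 : ℝ) ^ (7 : ℝ) by norm_num]
    exact Real.logb_rpow (by norm_num) (by norm_num)
  rw [h7]; norm_num

/-- **Corollary: every constant level is fooled on `K₃`** — for every `k` there is a
non-3-colourable finite graph that is cohomologically `k`-consistent w.r.t. `K₃`: the shape of
crux `CohConsistencyFooledByThreeCol` of route PneNP/DescentTower over the tree notion
`GraphCohomologicallyKConsistent` (the item's inline self-supporting-family rendering is bridged by
`graphCohomologicallyKConsistent_iff_exists`).  PROVED from the named fact.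
[cite: ConnerydGhannanePang2025, Thm. 6.1] -/
theorem const (h : connerydGhannanePang2025_thm_6_1) (k : ℕ) :
    ∃ (n : ℕ) (G : SimpleGraph (Fin n)), ¬ G.Colorable 3 ∧
      GraphCohomologicallyKConsistent k G (⊤ : SimpleGraph (Fin 3)) := by
  obtain ⟨c, hc, hn⟩ := linear h
  have hev : ∀ᶠ n : ℕ in atTop, (k : ℝ) ≤ c * n :=
    (tendsto_natCast_atTop_atTop.const_mul_atTop hc).eventually_ge_atTop (k : ℝ)
  obtain ⟨n, ⟨G, hG, hk⟩, hkn⟩ := (hn.and hev).exists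
  exact ⟨n, G, hG, hk k hkn⟩

end connerydGhannanePang2025_thm_6_1

end Literature.ModelTheory.FiniteModelTheory

end
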